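import Literature.NumberTheory.Sieve.LargestPrimeFactorCubicSawtoothSums
import HarnessLib

/-!
# Weighted sums of the sawtooth function over a point set via exponential sums

Topic `Literature/NumberTheory/Sieve` (exponential sums; the weighted companion of
`LargestPrimeFactorCubicSawtoothSums.lean`).  For a finite family of real points `x_j` with REAL
weights `w_j`, `V ≥ 1`, `H = 5(2V + 1)`, `S_w(d) = ∑_j w_j e(d x_j)` and `S_{|w|}(d) = ∑_j |w_j| e(d x_j)`,
we PROVE (`abs_sum_mul_saw_le`)

  `|∑_j w_j ψ(x_j)| ≤ (1/π) ∑_{ν=1}^{V} |S_w(ν)|/ν + (3(2 + log(2V+1))/(2V+1)) ∑_{d=−H}^{H} |S_{|w|}(d)|`,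

`ψ(t) = t − [t] − 1/2` (`Literature.NumberTheory.LFunctions.AFE.saw`).  This is the classical
"Erdős–Turán for sums of `ψ`" step (truncated Fourier series of `ψ` plus a Fejér-smoothed majorant
of the truncation error, Montgomery, *Ten lectures*, Ch. 1) in the explicit finite form of the
unweighted `LargestPrimeFactorCubic.abs_sum_saw_le` of the tree (Heath-Brown, *The largest prime
factor of `X³ + 2`*, PLMS 82 (2001), §3, (3.4) and (2.9)), whose ingredients we reuse verbatim:

* the truncated series `ψ_V` summed with weights: `|∑_j w_j ψ_V(x_j)| ≤ (1/π) ∑_{ν ≤ V} |S_w(ν)|/ν`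
  (`abs_sum_mul_sawPartial_le`; `sin(2πνx) = Im e(νx)` and the weights are real);
* the error `|ψ − ψ_V| ≤ (3/2) G_κ`, `κ = 2/(3π(2V+1))` (`abs_saw_sub_sawPartial_le_tentG`), the
  pointwise domination `G_κ ≤ 4 (G_κ ∗ K_H)` by the Fejér smoothing (`tentG_le_four_mul_conv`), and the
  weighted form of "`K_H` is a trigonometric polynomial of degree `H` with coefficients in `[0,1]`":
  `∑_j |w_j| K_H(x_j − u) ≤ ∑_{|d| ≤ H} |S_{|w|}(d)|` (`sum_mul_fejerKernel_sub_le`), whence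
  `∑_j |w_j| (G ∗ K_H)(x_j) ≤ (∫_0^1 G) ∑_{|d| ≤ H} |S_{|w|}(d)|` (`sum_mul_convG_le`) and
  `∫_0^1 G ≤ 2κ(1 + log(1/2κ))` (`integral_tentG_le`).

The weights enter the majorant part only through `|w_j|` (the pointwise domination
`|w_j| |ψ − ψ_V|(x_j) ≤ 6 |w_j| (G ∗ K_H)(x_j)` needs `|w_j| ≥ 0`), exactly as in the unweighted case
`w_j = 1`.

## References

* H. L. Montgomery, *Ten lectures on the interface between analytic number theory and harmonic
  analysis*, CBMS 84 (1994), Ch. 1. [`Montgomery1994`]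
* D. R. Heath-Brown, *The largest prime factor of `X³ + 2`*, Proc. London Math. Soc. (3) 82 (2001)
  554–596, §3 (3.4), (2.9). [`HeathBrown2001LargestPrimeFactorCubic`]
* E. C. Titchmarsh, *The Theory of the Riemann Zeta-Function*, 2nd ed., §4.7. [`Titchmarsh1986`]
-/

noncomputable section

open Finset Real MeasureTheory intervalIntegral
open scoped FourierTransform

namespace Literature.NumberTheory.Sieve.WeightedSawtooth

open Literature.NumberTheory.Sieve.Vinogradov (norm_fourierChar)
open Literature.NumberTheory.Sieve.FejerCounting (fejerKernel fejerKernel_eq_sum continuous_fejerKernel)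
open Literature.NumberTheory.Sieve.LargestPrimeFactorCubic (tentG tentG_nonneg continuous_tentG
  intervalIntegrable_tentG integral_tentG_le convG tentG_le_four_mul_conv abs_saw_sub_sawPartial_le_tentG)
open Literature.NumberTheory.LFunctions.AFE (saw sawPartial)

variable {ι : Type*} {κ : ℝ}

/-! ### The Fejér kernel summed over the points with nonnegative weights -/

/-- **The Fejér kernel summed over weighted points**: for real weights `w_j` and every `u`,
`∑_j w_j K_H(x_j − u) ≤ ∑_{d=−H}^{H} |∑_j w_j e(d x_j)|` (`K_H` is a trigonometric polynomial of
degree `H` with coefficients in `[0, 1]`; the left side is the real part of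
`(H+1)⁻¹ ∑_{n,n'} e(−(n−n')u) ∑_j w_j e((n−n')x_j)`, so no sign condition on the weights is needed
here). [folklore] -/
theorem sum_mul_fejerKernel_sub_le (s : Finset ι) (w : ι → ℝ) (x : ι → ℝ) (H : ℕ) (u : ℝ) :
    ∑ j ∈ s, w j * fejerKernel H (x j - u) ≤
      ∑ d ∈ Icc (-(H : ℤ)) H, ‖∑ j ∈ s, (w j : ℂ) * (𝐞 ((d : ℝ) * x j) : ℂ)‖ := by
  classical
  set T : ℝ := ∑ d ∈ Icc (-(H : ℤ)) H, ‖∑ j ∈ s, (w j : ℂ) * (𝐞 ((d : ℝ) * x j) : ℂ)‖ with hT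
  have hHr : (0 : ℝ) < H + 1 := by positivity
  -- complex form
  have hsum : ((∑ j ∈ s, w j * fejerKernel H (x j - u) : ℝ) : ℂ) =
      ((H : ℂ) + 1)⁻¹ * ∑ n ∈ Ioc 0 (H + 1), ∑ n' ∈ Ioc 0 (H + 1),
        (𝐞 (-(((n : ℝ) - n') * u)) : ℂ) * ∑ j ∈ s, (w j : ℂ) * (𝐞 (((n : ℝ) - n') * x j) : ℂ) := by
    push_cast
    simp_rw [fejerKernel_eq_sum]
    calc ∑ j ∈ s, (w j : ℂ) * (((H : ℂ) + 1)⁻¹ *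
          ∑ n ∈ Ioc 0 (H + 1), ∑ n' ∈ Ioc 0 (H + 1), (𝐞 (((n : ℝ) - n') * (x j - u)) : ℂ))
        = ∑ j ∈ s, ∑ n ∈ Ioc 0 (H + 1), ∑ n' ∈ Ioc 0 (H + 1), ((H : ℂ) + 1)⁻¹ *
            ((𝐞 (-(((n : ℝ) - n') * u)) : ℂ) * ((w j : ℂ) * (𝐞 (((n : ℝ) - n') * x j) : ℂ))) := by
          refine Finset.sum_congr rfl fun j _ => ?_
          rw [Finset.mul_sum, Finset.mul_sum]
          refine Finset.sum_congr rfl fun n _ => ?_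
          rw [Finset.mul_sum, Finset.mul_sum]
          refine Finset.sum_congr rfl fun n' _ => ?_
          have e3 : (𝐞 (((n : ℝ) - n') * (x j - u)) : ℂ) =
              (𝐞 (-(((n : ℝ) - n') * u)) : ℂ) * (𝐞 (((n : ℝ) - n') * x j) : ℂ) := by
            rw [← Circle.coe_mul, ← AddChar.map_add_eq_mul]; congr 2; ring
          rw [e3]; ring
      _ = ((H : ℂ) + 1)⁻¹ * ∑ n ∈ Ioc 0 (H + 1), ∑ n' ∈ Ioc 0 (H + 1),
            (𝐞 (-(((n : ℝ) - n') * u)) : ℂ) * ∑ j ∈ s, (w j : ℂ) * (𝐞 (((n : ℝ) - n') * x j) : ℂ) := by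
          rw [Finset.sum_comm, Finset.mul_sum]
          refine Finset.sum_congr rfl fun n _ => ?_
          rw [Finset.sum_comm, Finset.mul_sum]
          refine Finset.sum_congr rfl fun n' _ => ?_
          rw [Finset.mul_sum, Finset.mul_sum]
  set P := Ioc 0 (H + 1) with hP
  have hreal : ∑ j ∈ s, w j * fejerKernel H (x j - u) =
      (((H : ℂ) + 1)⁻¹ * ∑ n ∈ P, ∑ n' ∈ P,
        (𝐞 (-(((n : ℝ) - n') * u)) : ℂ) * ∑ j ∈ s, (w j : ℂ) * (𝐞 (((n : ℝ) - n') * x j) : ℂ)).re := by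
    rw [← hsum, Complex.ofReal_re]
  rw [hreal]
  refine (Complex.re_le_norm _).trans ?_
  rw [norm_mul, norm_inv, show ‖((H : ℂ) + 1)‖ = (H : ℝ) + 1 by
    rw [show ((H : ℂ) + 1) = ((H + 1 : ℕ) : ℂ) by push_cast; ring, Complex.norm_natCast]; push_cast; ring]
  rw [inv_mul_le_iff₀ hHr]
  -- each inner sum over `n'` is at most `T`
  have hinner : ∀ n ∈ P, ‖∑ n' ∈ P,
      (𝐞 (-(((n : ℝ) - n') * u)) : ℂ) * ∑ j ∈ s, (w j : ℂ) * (𝐞 (((n : ℝ) - n') * x j) : ℂ)‖ ≤ T := by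
    intro n hn
    refine (norm_sum_le _ _).trans ?_
    have hterm : ∀ n' ∈ P,
        ‖(𝐞 (-(((n : ℝ) - n') * u)) : ℂ) * ∑ j ∈ s, (w j : ℂ) * (𝐞 (((n : ℝ) - n') * x j) : ℂ)‖
        = ‖∑ j ∈ s, (w j : ℂ) * (𝐞 ((((n : ℤ) - n' : ℤ) : ℝ) * x j) : ℂ)‖ := by
      intro n' _
      rw [norm_mul, norm_fourierChar, one_mul]
      push_cast; rfl
    rw [Finset.sum_congr rfl hterm]
    -- reindex by `d = n − n'`
    have hinj : Set.InjOn (fun n' : ℕ => (n : ℤ) - n') ↑P := by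
      intro a _ b _ h; simp only at h; omega
    rw [← Finset.sum_image
      (f := fun d : ℤ => ‖∑ j ∈ s, (w j : ℂ) * (𝐞 ((d : ℝ) * x j) : ℂ)‖) hinj]
    refine Finset.sum_le_sum_of_subset_of_nonneg (fun d hd => ?_) (fun _ _ _ => norm_nonneg _)
    rw [Finset.mem_image] at hd
    obtain ⟨n', hn', rfl⟩ := hd
    rw [hP, Finset.mem_Ioc] at hn hn'
    rw [Finset.mem_Icc]
    constructor <;> omega
  calc ‖∑ n ∈ P, ∑ n' ∈ P, (𝐞 (-(((n : ℝ) - n') * u)) : ℂ) *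
          ∑ j ∈ s, (w j : ℂ) * (𝐞 (((n : ℝ) - n') * x j) : ℂ)‖
      ≤ ∑ n ∈ P, ‖∑ n' ∈ P, (𝐞 (-(((n : ℝ) - n') * u)) : ℂ) *
          ∑ j ∈ s, (w j : ℂ) * (𝐞 (((n : ℝ) - n') * x j) : ℂ)‖ := norm_sum_le _ _
    _ ≤ ∑ _n ∈ P, T := Finset.sum_le_sum hinner
    _ = (H + 1) * T := by
        rw [Finset.sum_const, hP, Nat.card_Ioc, tsub_zero, nsmul_eq_mul]; push_cast; ring

/-- **The smoothed majorant summed over weighted points**: for real weights,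
`∑_j w_j (G ∗ K_H)(x_j) ≤ (∫_0^1 G) ∑_{|d| ≤ H} |∑_j w_j e(d x_j)|` (`G ≥ 0`). [folklore] -/
theorem sum_mul_convG_le (s : Finset ι) (w : ι → ℝ) (x : ι → ℝ) (hκ : 0 < κ) (H : ℕ) :
    ∑ j ∈ s, w j * convG κ H (x j) ≤
      (∫ u in (0 : ℝ)..1, tentG κ u) *
        ∑ d ∈ Icc (-(H : ℤ)) H, ‖∑ j ∈ s, (w j : ℂ) * (𝐞 ((d : ℝ) * x j) : ℂ)‖ := by
  have hcont : ∀ j, Continuous (fun u => tentG κ u * fejerKernel H (x j - u)) := fun j =>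
    (continuous_tentG hκ).mul ((continuous_fejerKernel H).comp (continuous_const.sub continuous_id))
  have hint : ∀ j ∈ s, IntervalIntegrable (fun u => w j * (tentG κ u * fejerKernel H (x j - u)))
      volume 0 1 := fun j _ => (continuous_const.mul (hcont j)).intervalIntegrable _ _
  have e0 : ∀ j ∈ s, w j * convG κ H (x j) =
      ∫ u in (0 : ℝ)..1, w j * (tentG κ u * fejerKernel H (x j - u)) := by
    intro j _
    unfold convG
    rw [intervalIntegral.integral_const_mul]
  rw [Finset.sum_congr rfl e0, ← intervalIntegral.integral_finsetSum hint]
  have e : ∀ u, ∑ j ∈ s, w j * (tentG κ u * fejerKernel H (x j - u)) =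
      tentG κ u * ∑ j ∈ s, w j * fejerKernel H (x j - u) := by
    intro u
    rw [Finset.mul_sum]
    refine Finset.sum_congr rfl fun j _ => ?_
    ring
  simp_rw [e]
  rw [← intervalIntegral.integral_mul_const]
  have hint2 : IntervalIntegrable (fun u => tentG κ u * ∑ j ∈ s, w j * fejerKernel H (x j - u))
      volume 0 1 :=
    ((continuous_tentG hκ).mul (continuous_finsetSum _ (fun j _ =>
      continuous_const.mul ((continuous_fejerKernel H).comp (continuous_const.sub continuous_id))))).intervalIntegrable _ _
  refine integral_mono_on zero_le_one hint2 ((intervalIntegrable_tentG hκ _ _).mul_const _)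
    (fun u _ => ?_)
  exact mul_le_mul_of_nonneg_left (sum_mul_fejerKernel_sub_le s w x H u) (tentG_nonneg hκ u)

/-! ### The truncated series with real weights -/

/-- The truncated series summed with real weights:
`|∑_j w_j ψ_V(x_j)| ≤ (1/π) ∑_{ν=1}^{V} |∑_j w_j e(ν x_j)|/ν` (`sin(2πνx) = Im e(νx)` and `w_j ∈ ℝ`).
[folklore] -/
theorem abs_sum_mul_sawPartial_le (s : Finset ι) (w : ι → ℝ) (x : ι → ℝ) (V : ℕ) :
    |∑ j ∈ s, w j * sawPartial V (x j)| ≤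
      (1 / π) * ∑ ν ∈ Icc 1 V, ‖∑ j ∈ s, (w j : ℂ) * (𝐞 ((ν : ℝ) * x j) : ℂ)‖ / ν := by
  have hsin : ∀ (ν : ℕ) (j : ι), w j * Real.sin (2 * π * ν * x j) =
      ((w j : ℂ) * (𝐞 ((ν : ℝ) * x j) : ℂ)).im := by
    intro ν j
    rw [Complex.im_ofReal_mul, Real.fourierChar_apply, Complex.exp_ofReal_mul_I_im]
    congr 2; ring
  have e1 : ∑ j ∈ s, w j * sawPartial V (x j) =
      -∑ ν ∈ Icc 1 V, (∑ j ∈ s, (w j : ℂ) * (𝐞 ((ν : ℝ) * x j) : ℂ)).im / (π * ν) := by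
    have e2 : ∀ j ∈ s, w j * sawPartial V (x j) =
        -∑ ν ∈ Icc 1 V, ((w j : ℂ) * (𝐞 ((ν : ℝ) * x j) : ℂ)).im / (π * ν) := by
      intro j _
      rw [Literature.NumberTheory.LFunctions.AFE.sawPartial_def, mul_neg, Finset.mul_sum]
      congr 1
      refine Finset.sum_congr rfl (fun ν _ => ?_)
      rw [← hsin, mul_div_assoc]
    rw [Finset.sum_congr rfl e2, Finset.sum_neg_distrib, Finset.sum_comm]
    congr 1
    refine Finset.sum_congr rfl (fun ν _ => ?_)
    rw [Complex.im_sum, Finset.sum_div]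
  rw [e1, abs_neg, Finset.mul_sum]
  refine (Finset.abs_sum_le_sum_abs _ _).trans (Finset.sum_le_sum (fun ν hν => ?_))
  rw [Finset.mem_Icc] at hν
  have hν0 : (0 : ℝ) < ν := by exact_mod_cast hν.1
  rw [abs_div, abs_of_pos (by positivity : (0 : ℝ) < π * ν)]
  rw [show 1 / π * (‖∑ j ∈ s, (w j : ℂ) * (𝐞 ((ν : ℝ) * x j) : ℂ)‖ / ν) =
      ‖∑ j ∈ s, (w j : ℂ) * (𝐞 ((ν : ℝ) * x j) : ℂ)‖ / (π * ν) by field_simp]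
  exact div_le_div_of_nonneg_right (Complex.abs_im_le_norm _) (by positivity)

/-! ### The main estimate -/

/-- **Weighted sums of the sawtooth over a point set** (the weighted form of Heath-Brown's (3.4)
step; Erdős–Turán for `ψ`-sums, Montgomery Ch. 1): for any finite family of reals `x_j` with real
weights `w_j`, `V ≥ 1` and `H = 5(2V+1)`,
`|∑_j w_j ψ(x_j)| ≤ (1/π) ∑_{ν=1}^{V} |∑_j w_j e(ν x_j)|/ν
   + (3(2 + log(2V+1))/(2V+1)) ∑_{d=−H}^{H} |∑_j |w_j| e(d x_j)|`.
[folklore] -/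
theorem abs_sum_mul_saw_le (s : Finset ι) (w : ι → ℝ) (x : ι → ℝ) {V : ℕ} (hV : 1 ≤ V) :
    |∑ j ∈ s, w j * saw (x j)| ≤
      (1 / π) * ∑ ν ∈ Icc 1 V, ‖∑ j ∈ s, (w j : ℂ) * (𝐞 ((ν : ℝ) * x j) : ℂ)‖ / ν +
        3 * (2 + Real.log (2 * V + 1)) / (2 * V + 1) *
          ∑ d ∈ Icc (-((5 * (2 * V + 1) : ℕ) : ℤ)) (5 * (2 * V + 1) : ℕ),
            ‖∑ j ∈ s, ((|w j| : ℝ) : ℂ) * (𝐞 ((d : ℝ) * x j) : ℂ)‖ := by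
  set κ : ℝ := 2 / (3 * π * (2 * V + 1)) with hκ
  set H : ℕ := 5 * (2 * V + 1) with hH
  set T : ℝ := ∑ d ∈ Icc (-(H : ℤ)) H, ‖∑ j ∈ s, ((|w j| : ℝ) : ℂ) * (𝐞 ((d : ℝ) * x j) : ℂ)‖ with hT
  have hV1 : (1 : ℝ) ≤ V := by exact_mod_cast hV
  have hπ3 : (3 : ℝ) < π := Real.pi_gt_three
  have hπ4 : π < 3.15 := Real.pi_lt_d2
  have hκ0 : 0 < κ := by rw [hκ]; positivity
  have h2V : (3 : ℝ) ≤ 2 * V + 1 := by linarith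
  have hκ2 : κ ≤ 1 / 2 := by
    rw [hκ, div_le_iff₀ (by positivity)]; nlinarith
  have hHκ : 1 / ((H : ℝ) + 1) ≤ κ := by
    rw [hH, hκ]; push_cast
    rw [div_le_div_iff₀ (by positivity) (by positivity)]; nlinarith
  have hT0 : 0 ≤ T := Finset.sum_nonneg (fun _ _ => norm_nonneg _)
  -- split `ψ = ψ_V + (ψ − ψ_V)`
  have hsplit : ∑ j ∈ s, w j * saw (x j) =
      ∑ j ∈ s, w j * sawPartial V (x j) + ∑ j ∈ s, w j * (saw (x j) - sawPartial V (x j)) := by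
    rw [← Finset.sum_add_distrib]
    refine Finset.sum_congr rfl fun j _ => ?_
    ring
  rw [hsplit]
  refine (abs_add_le _ _).trans (add_le_add (abs_sum_mul_sawPartial_le s w x V) ?_)
  -- the error terms, with the nonnegative weights `|w_j|`
  have herr : |∑ j ∈ s, w j * (saw (x j) - sawPartial V (x j))| ≤
      3 / 2 * ∑ j ∈ s, |w j| * tentG κ (x j) := by
    refine (Finset.abs_sum_le_sum_abs _ _).trans ?_
    rw [Finset.mul_sum]
    refine Finset.sum_le_sum (fun j _ => ?_)
    rw [abs_mul]
    calc |w j| * |saw (x j) - sawPartial V (x j)| ≤ |w j| * (3 / 2 * tentG κ (x j)) :=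
          mul_le_mul_of_nonneg_left (abs_saw_sub_sawPartial_le_tentG V (x j)) (abs_nonneg _)
      _ = 3 / 2 * (|w j| * tentG κ (x j)) := by ring
  have hG : ∑ j ∈ s, |w j| * tentG κ (x j) ≤ 4 * ((∫ u in (0 : ℝ)..1, tentG κ u) * T) := by
    calc ∑ j ∈ s, |w j| * tentG κ (x j) ≤ ∑ j ∈ s, |w j| * (4 * convG κ H (x j)) :=
          Finset.sum_le_sum (fun j _ => mul_le_mul_of_nonneg_left
            (tentG_le_four_mul_conv hκ0 hκ2 hHκ (x j)) (abs_nonneg _))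
      _ = 4 * ∑ j ∈ s, |w j| * convG κ H (x j) := by
          rw [Finset.mul_sum]
          refine Finset.sum_congr rfl fun j _ => ?_
          ring
      _ ≤ 4 * ((∫ u in (0 : ℝ)..1, tentG κ u) * T) := by
          refine mul_le_mul_of_nonneg_left ?_ (by norm_num)
          have h := sum_mul_convG_le s (fun j => |w j|) x hκ0 H
          refine h.trans (le_of_eq ?_)
          rw [hT]
  have hI := integral_tentG_le hκ0 hκ2
  -- numerics: `6 · 2κ(1 + log(1/(2κ))) ≤ 3(2 + log(2V+1))/(2V+1)`
  have hlog : Real.log (1 / (2 * κ)) ≤ 1 + Real.log (2 * V + 1) := by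
    have e : 1 / (2 * κ) = (3 * π / 4) * (2 * V + 1) := by rw [hκ]; field_simp; ring
    rw [e, Real.log_mul (by positivity) (by positivity)]
    have : Real.log (3 * π / 4) ≤ 1 := by
      rw [Real.log_le_iff_le_exp (by positivity)]
      have := Real.exp_one_gt_d9
      nlinarith
    linarith
  have hlog0 : 0 ≤ Real.log (2 * V + 1) := Real.log_nonneg (by linarith)
  have hκ' : 12 * κ ≤ 3 / (2 * V + 1) := by
    have e : 12 * κ = 8 / (π * (2 * V + 1)) := by rw [hκ]; field_simp; ring
    rw [e, div_le_div_iff₀ (by positivity) (by positivity)]; nlinarith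
  calc |∑ j ∈ s, w j * (saw (x j) - sawPartial V (x j))|
      ≤ 3 / 2 * (4 * ((∫ u in (0 : ℝ)..1, tentG κ u) * T)) := herr.trans (by gcongr)
    _ = 6 * (∫ u in (0 : ℝ)..1, tentG κ u) * T := by ring
    _ ≤ 6 * (2 * κ * (1 + Real.log (1 / (2 * κ)))) * T := by gcongr
    _ ≤ 6 * (2 * κ * (2 + Real.log (2 * V + 1))) * T := by
        apply mul_le_mul_of_nonneg_right _ hT0
        apply mul_le_mul_of_nonneg_left _ (by norm_num)
        exact mul_le_mul_of_nonneg_left (by linarith) (by positivity)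
    _ = 12 * κ * (2 + Real.log (2 * V + 1)) * T := by ring
    _ ≤ 3 / (2 * V + 1) * (2 + Real.log (2 * V + 1)) * T := by
        gcongr
    _ = 3 * (2 + Real.log (2 * V + 1)) / (2 * V + 1) * T := by ring

end Literature.NumberTheory.Sieve.WeightedSawtooth

end
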